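import Summits.QuantumFields.GaugeBoot.Rows.GLYZc2D4STab
import HarnessLib

/-!
# Gauge-boot: kernel check of the raw `site1` class table of the glyz-c2-4D problems, rows 88–113 (part 5/10)

Cell `pub-gaugeboot` (HOME `run/shared/lean/pub/pub-gaugeboot/`), seat lean1 (torus layer for rows C76–C87 = the certified
glyz-c2-4D windows: label set, raw blocks, class/witness tables, the reduction identity, per-β bindings).

HONEST FRAMING (page 1 of every file of this cell): certified bounds on lattice expectations at STATED coupling,
gauge group, dimension and torus size; NOT a mass gap, NOT a continuum limit, NOT a string tension, NOT large `N`.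
The venture is explicitly NOT Yang–Mills-summit-bearing (barriers `FixedCouplingUltralocality`,
`PerturbativeInvisibility`).

`scanon_rows_<lo>_<hi> : ∀ i, lo ≤ i < hi → ∀ j ≥ i, GLYZc2D4.SCanonOK i j`, each range one closed computation (`decide +kernel`);
assembled in `GLYZc2D4Canon`.
-/

noncomputable section

open Literature.MathematicalPhysics.QuantumFieldTheory

namespace Summit.QuantumFields.GaugeBoot

namespace GLYZc2D4

set_option maxHeartbeats 0 in
/-- Rows `88 ≤ i < 93` of the `site1` class table of the glyz-c2-4D problems canonicalise (1230 entries; kernel). -/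
theorem scanon_rows_88_93 : ∀ i : Fin 336, 88 ≤ i.val → i.val < 93 → ∀ j : Fin 336, i.val ≤ j.val → GLYZc2D4.SCanonOK i j := by
  decide +kernel

set_option maxHeartbeats 0 in
/-- Rows `93 ≤ i < 98` of the `site1` class table of the glyz-c2-4D problems canonicalise (1205 entries; kernel). -/
theorem scanon_rows_93_98 : ∀ i : Fin 336, 93 ≤ i.val → i.val < 98 → ∀ j : Fin 336, i.val ≤ j.val → GLYZc2D4.SCanonOK i j := by
  decide +kernel

set_option maxHeartbeats 0 in
/-- Rows `98 ≤ i < 103` of the `site1` class table of the glyz-c2-4D problems canonicalise (1180 entries; kernel). -/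
theorem scanon_rows_98_103 : ∀ i : Fin 336, 98 ≤ i.val → i.val < 103 → ∀ j : Fin 336, i.val ≤ j.val → GLYZc2D4.SCanonOK i j := by
  decide +kernel

set_option maxHeartbeats 0 in
/-- Rows `103 ≤ i < 108` of the `site1` class table of the glyz-c2-4D problems canonicalise (1155 entries; kernel). -/
theorem scanon_rows_103_108 : ∀ i : Fin 336, 103 ≤ i.val → i.val < 108 → ∀ j : Fin 336, i.val ≤ j.val → GLYZc2D4.SCanonOK i j := by
  decide +kernel

set_option maxHeartbeats 0 in
/-- Rows `108 ≤ i < 114` of the `site1` class table of the glyz-c2-4D problems canonicalise (1353 entries; kernel). -/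
theorem scanon_rows_108_114 : ∀ i : Fin 336, 108 ≤ i.val → i.val < 114 → ∀ j : Fin 336, i.val ≤ j.val → GLYZc2D4.SCanonOK i j := by
  decide +kernel

end GLYZc2D4

end Summit.QuantumFields.GaugeBoot

end
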